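import Literature.AlgebraicGeometry.ComplexMultiplication.JointEigenvectorsOfSemisimpleAction
import HarnessLib

/-!
# The joint eigencharacter of a joint eigenvector of a commuting family extends to an eigensystem of `ℚ[T_k]`

Generic linear algebra next to `JointEigenvectorsOfSemisimpleAction` (`exists_algHom_eq_of_eigenvector_ne_zero`: the
eigencharacter of a non-zero joint eigenvector of a COMMUTATIVE `ℚ`-algebra acting on `V` is a `ℚ`-algebra homomorphism),
in FAMILY form: for a family `T : κ → End_ℚ V`, a vector `w ∈ ℂ ⊗_ℚ V` with `(T k)_ℂ w = χ k • w` for all `k`: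

* `exists_baseChange_apply_eq_smul_of_mem_adjoin` — every element of the generated algebra `ℚ[T k : k]` acts on `w` by
  a scalar (induction on `Algebra.adjoin`: generators by `χ k`, scalars `r ∈ ℚ` by `r`, sums and products);
* `exists_algHom_adjoin_of_jointEigenvector_ne_zero` — if the `T k` pairwise COMMUTE and `w ≠ 0`, the joint
  eigencharacter `χ` is the restriction of an EIGENSYSTEM `t : ℚ[T k : k] →ₐ[ℚ] ℂ`: `t (T k) = χ k` and
  `a_ℂ w = t a • w` for every `a ∈ ℚ[T k : k]` (the commutative-ring structure of `ℚ[T k : k]` is Mathlib's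
  `Algebra.isMulCommutative_adjoin`).

This is how an occurring joint Hecke eigencharacter on `H¹(X(ℂ); ℂ)` becomes the datum `(R := ℚ[T_k], act := val, t)`
of an occurring eigensystem, to which the tree's `EigenblockOfCommutingEndomorphisms` (`eigenblock`, `eigenfield`)
applies (Deligne: `e ∈ E` acts on `H¹_{B,σ}` as `σ(e)`).  Cell pub-hodgecm2, lane «L-BYPASS» (kernel text by the seat
pub-hodgecm2-s2crux-idea-2, probe `RA-v36` Part O §O.1, gen 8; filed by b10).  Theorems only; no named fact.

References: P. Deligne, *Hodge cycles on abelian varieties*, in LNM 900 (1982), §4 (p. 30) and I §5 Prop. 5.1 (proof)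
[Deligne1982HodgeCycles].
-/

noncomputable section

namespace Literature.AlgebraicGeometry.ComplexMultiplication

open scoped TensorProduct

section EigensystemOfFamily

variable {V : Type*} [AddCommGroup V] [Module ℚ V] {κ : Type*}

/-- Every element of the `ℚ`-algebra `ℚ[T_k : k]` generated by a family `T` acts on a joint eigenvector `w` of the
family by a scalar (induction on `Algebra.adjoin`: generators by `χ k`, scalars `r ∈ ℚ` by `r`, sums and products
of scalars). [cite: Deligne1982HodgeCycles, §4 (p. 30, `e ∈ E` acting on `H¹_{B,σ}` as `σ(e)`)] -/
theorem exists_baseChange_apply_eq_smul_of_mem_adjoin (T : κ → Module.End ℚ V) {χ : κ → ℂ} {w : ℂ ⊗[ℚ] V}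
    (hw : ∀ k, (T k).baseChange ℂ w = χ k • w) {a : Module.End ℚ V}
    (ha : a ∈ Algebra.adjoin ℚ (Set.range T)) : ∃ c : ℂ, a.baseChange ℂ w = c • w := by
  induction ha using Algebra.adjoin_induction with
  | mem x hx =>
    obtain ⟨k, rfl⟩ := hx
    exact ⟨χ k, hw k⟩
  | algebraMap r =>
    refine ⟨algebraMap ℚ ℂ r, ?_⟩
    rw [Algebra.algebraMap_eq_smul_one, LinearMap.baseChange_smul, LinearMap.baseChange_one,
      LinearMap.smul_apply, Module.End.one_apply, algebraMap_smul]
  | add x y _ _ hx hy =>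
    obtain ⟨c, hc⟩ := hx
    obtain ⟨d, hd⟩ := hy
    exact ⟨c + d, by rw [LinearMap.baseChange_add, LinearMap.add_apply, hc, hd, add_smul]⟩
  | mul x y _ _ hx hy =>
    obtain ⟨c, hc⟩ := hx
    obtain ⟨d, hd⟩ := hy
    exact ⟨d * c, by rw [LinearMap.baseChange_mul, Module.End.mul_apply, hd, LinearMap.map_smul, hc, smul_smul]⟩

open scoped IsMulCommutative in
/-- **The joint eigencharacter of a non-zero joint eigenvector of a commuting family is (the restriction of) an
eigensystem of `ℚ[T_k]`.** If `T : κ → End_ℚ V` pairwise commute and `w ≠ 0` in `ℂ ⊗_ℚ V` has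
`(T k)_ℂ w = χ k • w` for all `k`, then there is a `ℚ`-algebra homomorphism `t : ℚ[T_k] →ₐ[ℚ] ℂ` with `t (T_k) = χ k`
and `a_ℂ w = t a • w` for every `a ∈ ℚ[T_k]` (scalars by `exists_baseChange_apply_eq_smul_of_mem_adjoin`, algebra
homomorphism by the tree's `exists_algHom_eq_of_eigenvector_ne_zero` on the commutative ring `ℚ[T_k]`).
[cite: Deligne1982HodgeCycles, §4 (p. 30, `e ∈ E` acting on `H¹_{B,σ}` as `σ(e)`)] -/
theorem exists_algHom_adjoin_of_jointEigenvector_ne_zero (T : κ → Module.End ℚ V)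
    (hc : ∀ k l, Commute (T k) (T l)) {χ : κ → ℂ} {w : ℂ ⊗[ℚ] V}
    (hw : ∀ k, (T k).baseChange ℂ w = χ k • w) (hw0 : w ≠ 0) :
    ∃ t : ↥(Algebra.adjoin ℚ (Set.range T)) →ₐ[ℚ] ℂ,
      (∀ k, t ⟨T k, Algebra.subset_adjoin ⟨k, rfl⟩⟩ = χ k) ∧
      ∀ a : ↥(Algebra.adjoin ℚ (Set.range T)), (a : Module.End ℚ V).baseChange ℂ w = t a • w := by
  classical
  haveI := Algebra.isMulCommutative_adjoin ℚ (s := Set.range T)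
    (by rintro _ ⟨k, rfl⟩ _ ⟨l, rfl⟩; exact (hc k l).eq)
  choose c hc' using fun a : ↥(Algebra.adjoin ℚ (Set.range T)) =>
    exists_baseChange_apply_eq_smul_of_mem_adjoin T hw a.2
  obtain ⟨t, ht⟩ := exists_algHom_eq_of_eigenvector_ne_zero (Algebra.adjoin ℚ (Set.range T)).val
    (χ := c) (w := w) (fun a => hc' a) hw0
  have hcancel : ∀ x y : ℂ, x • w = y • w → x = y := by
    intro x y hxy
    by_contra hne
    apply hw0
    have h0 : (x - y) • w = 0 := by rw [sub_smul, hxy, sub_self]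
    exact (smul_eq_zero.1 h0).resolve_left (sub_ne_zero.2 hne)
  refine ⟨t, fun k => ?_, fun a => by rw [ht a]; exact hc' a⟩
  rw [ht]
  exact hcancel _ _ (by rw [← hc' ⟨T k, Algebra.subset_adjoin ⟨k, rfl⟩⟩]; exact hw k)

end EigensystemOfFamily

end Literature.AlgebraicGeometry.ComplexMultiplication

end
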